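import Summits.PneNP.PneNP.Theorems.PhaseTwinsPseudorandomTwinsImplyTargetMachine
import Summits.PneNP.PneNP.Theorems.PhaseTwinsPseudorandomTwinsImplyTargetBounds

/-!
# Glue `PseudorandomTwinsImplyTarget` (stmt-PneNP-2723): pseudorandom twins above `λ_c` exclude FBPP approximation

Route PneNP/PhaseTwins, support item stmt-PneNP-2723: a proof of
`Summit.PneNP.PneNP.Theses.PhaseTwins.PseudorandomTwinsImplyTarget`, i.e.
`PseudorandomTwinsAbove → NoFBPPApproxAboveUniqueness`, AS TYPED (index-free distinguishers).

Proof (coin-length advice; the route's original "sample a fresh NO-instance and compare" needs the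
index `1ⁿ`, which clause (i) does not hand to the test). Let `(Δ, p, q, D₀, D₁, t)` witness the crux
and suppose `F ∈ FP`, `c`, `r` violate `X` at `(Δ, p, q)`; use accuracy `kη = 7` and confidence
`kδ = 16`.
1. Length escape (tree: `Negative.shortStrings_mass_tendsto_zero`, from clause (i) against
   finite-set tests and clause (ii)): short strings carry vanishing mass under both ensembles; with
   tightness of single distributions this yields indices `n₁ < n₂ < ⋯` and lengths `L₀ < L₁ < ⋯` such
   that `Dᵢ(n_k)` puts mass `≥ 1 - 2/16` on the length block `(L_{k-1}, L_k]`, while the YES/NO events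
   of clause (ii) have mass `≥ 15/16` and `t(n_k) ≥ 1`.
2. The advice: for `ℓ ∈ (L_{k-1}, L_k]` put `adv ℓ = min ⌊log₂ ⌊7 t(n_k)/2⌋⌋ (B ℓ)`, `B ℓ` a
   polynomial bound on the length of `F`'s answers; the test of `AdviceTest.exists_adviceTest`
   (part 1) with coin budget
   `M ℓ + adv ℓ` runs `F` once and accepts iff the answer is longer than `adv ℓ`. It is PPT.
3. On a YES-instance (`N ≥ 8t`) a good coin string (`15/16` of them) gives an answer of length
   `> ⌊log₂ ⌊7t/2⌋⌋ ≥ adv`, on a NO-instance (`1 ≤ N ≤ t`) of length `≤ ⌊log₂ ⌊7t/2⌋⌋` and `≤ B`, hence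
   `≤ adv` (part 2): acceptance `≥ 15/16` resp. `≤ 1/16`. So the gap of clause (i) at `n_k` is
   `≥ (15/16)(13/16) - (1/16 + 3/16) = 131/256 > 1/2` for every `k`, contradicting clause (i).
Samplability of `D₀, D₁` is not used.
-/

set_option linter.dupNamespace false -- `Summit.PneNP.PneNP.…`: summit = sub-problem (D-0017)

namespace Summit.PneNP.PneNP.Theorems

open Filter Topology Polynomial
open Literature.Computability.Complexity Literature.Computability.MetaComplexity
open Summit.PneNP.PneNP.Theorems.PseudorandomTwinsAbove.Negative
open _root_.Computability

namespace AdviceTest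

noncomputable section

/-- **One block of the gliding construction.** At an index `n` where `t n ≥ 1`, the YES/NO events
have mass `≥ 15/16`, and both ensembles live on the length block `(L, L']` up to `2/16`, a test whose
acceptance probability is that of the advice threshold test with `adv = min ⌊log₂ ⌊7 t/2⌋⌋ B` on that
block has acceptance gap `≥ 1/2`. [this work] -/
theorem block_gap {N : List Bool → ℕ} {F : List Bool → List Bool} {r M : Polynomial ℕ}
    {adv B : ℕ → ℕ} {a : List Bool → ℝ}
    (hpr : ∀ x : List Bool, a x = uniformProb (M.eval x.length)
      {u | adv x.length < (F (countQuery x (r.eval x.length) 7 16 u)).length})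
    (hgood : ∀ x : List Bool, uniformProb (M.eval x.length)
      {u | u ∉ {u | IsApproxCount 7 (N x) (countEstimate F x (r.eval x.length) 7 16 u)}} ≤ 1 / 16)
    (hcap : ∀ x u : List Bool, u.length = M.eval x.length →
      (F (countQuery x (r.eval x.length) 7 16 u)).length ≤ B x.length)
    (D₀ D₁ : Ensemble) (n tn L L' : ℕ) (ht : 0 < tn)
    (hadv : ∀ ℓ, L < ℓ → ℓ ≤ L' → adv ℓ = min (Nat.log 2 (7 * tn / 2)) (B ℓ))
    (hU : 15 / 16 ≤ D₀.prob n {x | 8 * tn ≤ N x})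
    (hV : 15 / 16 ≤ D₁.prob n {x | 0 < N x ∧ N x ≤ tn})
    (hlo₀ : D₀.prob n {x | x.length ≤ L} ≤ 1 / 16) (hlo₁ : D₁.prob n {x | x.length ≤ L} ≤ 1 / 16)
    (hhi₀ : D₀.prob n {x | L' < x.length} ≤ 1 / 16) (hhi₁ : D₁.prob n {x | L' < x.length} ≤ 1 / 16) :
    (1 : ℝ) / 2 ≤ |(∑' x, ((D₀ n) x).toReal * a x) - (∑' x, ((D₁ n) x).toReal * a x)| := by
  have ha0 : ∀ x, 0 ≤ a x := fun x => by rw [hpr]; exact uniformProb_nonneg _ _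
  have ha1 : ∀ x, a x ≤ 1 := fun x => by rw [hpr]; exact uniformProb_le_one _ _
  -- YES-instances in the block are accepted with probability ≥ 15/16
  set S₀ : Set (List Bool) := {x | 8 * tn ≤ N x} ∩ {x | L < x.length ∧ x.length ≤ L'} with hS₀
  have hyes : ∀ x ∈ S₀, (15 : ℝ) / 16 ≤ a x := by
    rintro x ⟨hx, hxl, hxr⟩
    change 8 * tn ≤ N x at hx
    rw [hpr]
    have h := one_sub_le_uniformProb (hgood x)
      (A := {u | adv x.length < (F (countQuery x (r.eval x.length) 7 16 u)).length}) ?_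
    · linarith
    · intro u _ hu
      change IsApproxCount 7 (N x) (countEstimate F x (r.eval x.length) 7 16 u) at hu
      rw [countEstimate_def] at hu
      have hlt := octave_lt_length_of_approx ht hx hu
      change adv x.length < _
      rw [hadv x.length hxl hxr]
      exact (min_le_left _ _).trans_lt hlt
  -- NO-instances in the block are accepted with probability ≤ 1/16
  set S₁ : Set (List Bool) := {x | 0 < N x ∧ N x ≤ tn} ∩ {x | L < x.length ∧ x.length ≤ L'} with hS₁
  have hno : ∀ x ∈ S₁, a x ≤ (1 : ℝ) / 16 := by
    rintro x ⟨⟨hpos, hle⟩, hxl, hxr⟩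
    rw [hpr]
    refine uniformProb_le_of_subset_compl (hgood x) fun u hu hacc hG => ?_
    change IsApproxCount 7 (N x) (countEstimate F x (r.eval x.length) 7 16 u) at hG
    change adv x.length < _ at hacc
    rw [countEstimate_def] at hG
    have h1 := length_le_octave_of_approx hpos hle hG
    have h2 := hcap x u hu
    rw [hadv x.length hxl hxr] at hacc
    have := lt_of_lt_of_le hacc (le_min h1 h2)
    exact lt_irrefl _ this
  -- masses of the two good sets
  have hmass : ∀ (D : Ensemble) (U : Set (List Bool)), 15 / 16 ≤ D.prob n U →
      D.prob n {x | x.length ≤ L} ≤ 1 / 16 → D.prob n {x | L' < x.length} ≤ 1 / 16 →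
      (13 : ℝ) / 16 ≤ D.prob n (U ∩ {x | L < x.length ∧ x.length ≤ L'}) ∧
        D.prob n (U ∩ {x | L < x.length ∧ x.length ≤ L'})ᶜ ≤ 3 / 16 := by
    intro D U hDU hlo hhi
    have hsub : (U ∩ {x | L < x.length ∧ x.length ≤ L'})ᶜ ⊆
        (Uᶜ ∪ {x | x.length ≤ L}) ∪ {x | L' < x.length} := by
      intro x hx
      by_cases hxU : x ∈ U
      · have : ¬ (L < x.length ∧ x.length ≤ L') := fun h => hx ⟨hxU, h⟩
        by_cases h1 : x.length ≤ L
        · exact Or.inl (Or.inr h1)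
        · exact Or.inr (by change L' < x.length; omega)
      · exact Or.inl (Or.inl hxU)
    have hc := mass_add_compl (D n) U
    have hc' := mass_add_compl (D n) (U ∩ {x | L < x.length ∧ x.length ≤ L'})
    have hm := mass_mono (D n) hsub
    have hu1 := mass_union_le (D n) (Uᶜ ∪ {x | x.length ≤ L}) {x | L' < x.length}
    have hu2 := mass_union_le (D n) Uᶜ {x | x.length ≤ L}
    change 15 / 16 ≤ (PMF.toOuterMeasure (D n) U).toReal at hDU
    change (PMF.toOuterMeasure (D n) _).toReal ≤ 1 / 16 at hlo
    change (PMF.toOuterMeasure (D n) _).toReal ≤ 1 / 16 at hhi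
    change 13 / 16 ≤ (PMF.toOuterMeasure (D n) _).toReal ∧ (PMF.toOuterMeasure (D n) _).toReal ≤ 3 / 16
    constructor <;> linarith
  obtain ⟨h₀S, -⟩ := hmass D₀ _ hU hlo₀ hhi₀
  obtain ⟨-, h₁S⟩ := hmass D₁ _ hV hlo₁ hhi₁
  -- the two functionals
  have hlow : (15 : ℝ) / 16 * (13 / 16) ≤ ∑' x, ((D₀ n) x).toReal * a x := by
    have h := mul_mass_le_tsum (D₀ n) S₀ ha0 ha1 (by norm_num : (0 : ℝ) ≤ 15 / 16) hyes
    change (13 : ℝ) / 16 ≤ (PMF.toOuterMeasure (D₀ n) S₀).toReal at h₀S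
    nlinarith
  have hupp : ∑' x, ((D₁ n) x).toReal * a x ≤ 1 / 16 + 3 / 16 := by
    have h := tsum_le_add_mass_compl (D₁ n) S₁ ha0 ha1 (by norm_num : (0 : ℝ) ≤ 1 / 16) hno
    change (PMF.toOuterMeasure (D₁ n) S₁ᶜ).toReal ≤ 3 / 16 at h₁S
    linarith
  rw [le_abs]
  exact Or.inl (by linarith)

/-- **The glue, abstract form.** For ANY count function `N`: two ensembles satisfying clauses (i)
(index-free PPT indistinguishability) and (ii) (`N ≥ 8t` vs `0 < N ≤ t` a.a.s.) of the crux exclude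
an FBPP approximation scheme for `N` in the format of `X` (`countQuery` / `countEstimate` /
`IsApproxCount`, failure `≤ 1/kδ` over `uniformProb`). [this work] -/
theorem no_fbpp_approximator_of_twins (N : List Bool → ℕ) (D₀ D₁ : Ensemble) (t : ℕ → ℕ)
    (hind : ∀ A : RandAlg (List Bool) Bool, A.IsPolyTime (id : List Bool → List Bool) encodeBool →
      Tendsto (fun n : ℕ => |(∑' x : List Bool, ((D₀ n) x).toReal * A.pr id x {b | b = true}) -
        (∑' x : List Bool, ((D₁ n) x).toReal * A.pr id x {b | b = true})|) atTop (𝓝 0))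
    (h₀ : Tendsto (fun n : ℕ => D₀.prob n {x | 8 * t n ≤ N x}) atTop (𝓝 1))
    (h₁ : Tendsto (fun n : ℕ => D₁.prob n {x | 0 < N x ∧ N x ≤ t n}) atTop (𝓝 1))
    {F : List Bool → List Bool} (hF : F ∈ FP) (c r : Polynomial ℕ)
    (happ : ∀ (x : List Bool) (kη kδ : ℕ), 0 < kη → 0 < kδ →
      uniformProb (c.eval (x.length + r.eval x.length + kη + kδ))
        {u | ¬ IsApproxCount kη (N x) (countEstimate F x (r.eval x.length) kη kδ u)} ≤ 1 / (kδ : ℝ)) :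
    False := by
  classical
  -- the coin polynomial at accuracy 7, confidence 16
  set M : Polynomial ℕ := c.comp (X + r + C 7 + C 16) with hM
  have hMeval : ∀ ℓ, M.eval ℓ = c.eval (ℓ + r.eval ℓ + 7 + 16) := fun ℓ => by
    simp only [hM, eval_comp, eval_add, eval_X, eval_C]
  have hgood : ∀ x : List Bool, uniformProb (M.eval x.length)
      {u | u ∉ {u | IsApproxCount 7 (N x) (countEstimate F x (r.eval x.length) 7 16 u)}} ≤ 1 / 16 := by
    intro x
    have h := happ x 7 16 (by norm_num) (by norm_num)
    have h16 : (1 : ℝ) / ((16 : ℕ) : ℝ) = 1 / 16 := by norm_num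
    rw [← hMeval, h16] at h
    exact h
  -- a polynomial cap on the length of the answers of `F`
  obtain ⟨pF, hpF⟩ := exists_poly_length_le_of_mem_FP hF
  set Q : Polynomial ℕ := 4 * X + 4 * r + M + C 74 with hQ
  have hlenq : ∀ x u : List Bool, u.length = M.eval x.length →
      (countQuery x (r.eval x.length) 7 16 u).length = Q.eval x.length := by
    intro x u hu
    have hun : ∀ k, (unaryEncodeNat k).length = k := fun k => by
      rw [OracleCompose.unaryEncodeNat_eq_replicate, List.length_replicate]
    simp only [countQuery, length_boolPair, hun, hu, hQ, eval_add, eval_mul, eval_X, eval_C,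
      eval_ofNat]
    omega
  set B : ℕ → ℕ := fun ℓ => pF.eval (Q.eval ℓ) with hB
  have hcap : ∀ x u : List Bool, u.length = M.eval x.length →
      (F (countQuery x (r.eval x.length) 7 16 u)).length ≤ B x.length := by
    intro x u hu
    have h := hpF (countQuery x (r.eval x.length) 7 16 u)
    rw [hlenq x u hu] at h
    exact h
  -- clause (ii): disjoint events, `t n ≥ 1` eventually, length escape
  have hUV : ∀ n, Disjoint {x | 8 * t n ≤ N x} {x | 0 < N x ∧ N x ≤ t n} := by
    intro n
    rw [Set.disjoint_left]
    rintro x (hx : 8 * t n ≤ N x) ⟨hpos, hle⟩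
    omega
  have ht : ∀ᶠ n in atTop, 0 < t n := by
    have e := h₁.eventually_const_lt (show (1 / 2 : ℝ) < 1 by norm_num)
    refine e.mono fun n hn => ?_
    by_contra h0
    have hempty : {x | 0 < N x ∧ N x ≤ t n} = ∅ := by
      ext x; simp only [Set.mem_setOf_eq, Set.mem_empty_iff_false, iff_false]; omega
    rw [hempty] at hn
    have h0' : D₁.prob n (∅ : Set (List Bool)) = 0 := by simp [Ensemble.prob]
    rw [h0'] at hn
    norm_num at hn
  have hesc := shortStrings_mass_tendsto_zero D₀ D₁ hind _ _ hUV h₀ h₁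
  -- good indices beyond any bound, and tight length windows beyond any bound
  have hstep : ∀ n₀ L₀ : ℕ, ∃ n, n₀ < n ∧ 0 < t n ∧
      D₀.prob n {x | x.length ≤ L₀} ≤ 1 / 16 ∧ D₁.prob n {x | x.length ≤ L₀} ≤ 1 / 16 ∧
      15 / 16 ≤ D₀.prob n {x | 8 * t n ≤ N x} ∧ 15 / 16 ≤ D₁.prob n {x | 0 < N x ∧ N x ≤ t n} := by
    intro n₀ L₀
    have e1 := (hesc L₀).1.eventually_lt_const (show (0 : ℝ) < 1 / 16 by norm_num)
    have e2 := (hesc L₀).2.eventually_lt_const (show (0 : ℝ) < 1 / 16 by norm_num)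
    have e3 := h₀.eventually_const_lt (show (15 / 16 : ℝ) < 1 by norm_num)
    have e4 := h₁.eventually_const_lt (show (15 / 16 : ℝ) < 1 by norm_num)
    obtain ⟨n, hn⟩ := ((eventually_gt_atTop n₀).and (ht.and (e1.and (e2.and (e3.and e4))))).exists
    exact ⟨n, hn.1, hn.2.1, hn.2.2.1.le, hn.2.2.2.1.le, hn.2.2.2.2.1.le, hn.2.2.2.2.2.le⟩
  have htight : ∀ n L₀ : ℕ, ∃ L, L₀ < L ∧ D₀.prob n {x | L < x.length} ≤ 1 / 16 ∧
      D₁.prob n {x | L < x.length} ≤ 1 / 16 := by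
    intro n L₀
    obtain ⟨L₁, hL₁, h1⟩ := exists_length_tail_le (D₀ n) (by norm_num : (0 : ℝ) < 1 / 16) L₀
    obtain ⟨L₂, hL₂, h2⟩ := exists_length_tail_le (D₁ n) (by norm_num : (0 : ℝ) < 1 / 16) L₁
    refine ⟨L₂, by omega, ?_, h2⟩
    have hsub : {x : List Bool | L₂ < x.length} ⊆ {x | L₁ < x.length} := fun x hx => by
      change L₂ < x.length at hx; change L₁ < x.length; omega
    exact (mass_mono (D₀ n) hsub).trans h1
  -- the recursion: state = (index, end of the length block)
  let nOf : ℕ × ℕ → ℕ := fun s => Classical.choose (hstep s.1 s.2)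
  have nOf_spec : ∀ s : ℕ × ℕ, s.1 < nOf s ∧ 0 < t (nOf s) ∧
      D₀.prob (nOf s) {x | x.length ≤ s.2} ≤ 1 / 16 ∧ D₁.prob (nOf s) {x | x.length ≤ s.2} ≤ 1 / 16 ∧
      15 / 16 ≤ D₀.prob (nOf s) {x | 8 * t (nOf s) ≤ N x} ∧
      15 / 16 ≤ D₁.prob (nOf s) {x | 0 < N x ∧ N x ≤ t (nOf s)} :=
    fun s => Classical.choose_spec (hstep s.1 s.2)
  let LOf : ℕ × ℕ → ℕ := fun s => Classical.choose (htight (nOf s) s.2)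
  have LOf_spec : ∀ s : ℕ × ℕ, s.2 < LOf s ∧ D₀.prob (nOf s) {x | LOf s < x.length} ≤ 1 / 16 ∧
      D₁.prob (nOf s) {x | LOf s < x.length} ≤ 1 / 16 :=
    fun s => Classical.choose_spec (htight (nOf s) s.2)
  let st : ℕ → ℕ × ℕ := fun k => Nat.rec (0, 0) (fun _ s => (nOf s, LOf s)) k
  have st_succ : ∀ k, st (k + 1) = (nOf (st k), LOf (st k)) := fun k => rfl
  let nk : ℕ → ℕ := fun k => (st k).1
  let Lk : ℕ → ℕ := fun k => (st k).2
  have nk_succ : ∀ k, nk (k + 1) = nOf (st k) := fun k => by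
    show (st (k + 1)).1 = _; rw [st_succ]
  have Lk_succ : ∀ k, Lk (k + 1) = LOf (st k) := fun k => by
    show (st (k + 1)).2 = _; rw [st_succ]
  have nk_strictMono : StrictMono nk := strictMono_nat_of_lt_succ fun k => by
    rw [nk_succ]; exact (nOf_spec (st k)).1
  have Lk_strictMono : StrictMono Lk := strictMono_nat_of_lt_succ fun k => by
    rw [Lk_succ]; exact (LOf_spec (st k)).1
  have hLk_ge : ∀ k, k ≤ Lk k := fun k => Lk_strictMono.id_le k
  -- the block index of a length
  have hex : ∀ ℓ : ℕ, ∃ k, ℓ ≤ Lk (k + 1) := fun ℓ => ⟨ℓ, (hLk_ge (ℓ + 1)).trans' (Nat.le_succ ℓ)⟩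
  let idx : ℕ → ℕ := fun ℓ => Nat.find (hex ℓ)
  have idx_spec : ∀ ℓ, ℓ ≤ Lk (idx ℓ + 1) := fun ℓ => Nat.find_spec (hex ℓ)
  have idx_eq : ∀ k ℓ, Lk k < ℓ → ℓ ≤ Lk (k + 1) → idx ℓ = k := by
    intro k ℓ h1 h2
    have hle : idx ℓ ≤ k := Nat.find_min' (hex ℓ) h2
    by_contra hne
    have hlt : idx ℓ + 1 ≤ k := by omega
    have h3 := idx_spec ℓ
    have h4 : Lk (idx ℓ + 1) ≤ Lk k := Lk_strictMono.monotone hlt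
    omega
  -- the advice and the test
  let adv : ℕ → ℕ := fun ℓ => min (Nat.log 2 (7 * t (nk (idx ℓ + 1)) / 2)) (B ℓ)
  have hadvB : ∀ ℓ, adv ℓ ≤ (pF.comp Q).eval ℓ := fun ℓ => by
    rw [eval_comp]; exact min_le_right _ _
  obtain ⟨A, hA, hprA⟩ := exists_adviceTest hF r M 7 16 adv hadvB
  -- the gap on every block
  have hgap : ∀ k, (1 : ℝ) / 2 ≤
      |(∑' x, ((D₀ (nk (k + 1))) x).toReal * A.pr id x {b | b = true}) -
        (∑' x, ((D₁ (nk (k + 1))) x).toReal * A.pr id x {b | b = true})| := by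
    intro k
    have hs := nOf_spec (st k)
    have hL := LOf_spec (st k)
    rw [← nk_succ] at hs hL
    rw [← Lk_succ] at hL
    refine block_gap hprA hgood hcap D₀ D₁ (nk (k + 1)) (t (nk (k + 1))) (Lk k) (Lk (k + 1)) hs.2.1
      (fun ℓ h1 h2 => ?_) hs.2.2.2.2.1 hs.2.2.2.2.2 hs.2.2.1 hs.2.2.2.1 hL.2.1 hL.2.2
    show min (Nat.log 2 (7 * t (nk (idx ℓ + 1)) / 2)) (B ℓ) = _
    rw [idx_eq k ℓ h1 h2]
  -- contradiction with clause (i) along the subsequence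
  have hsm : StrictMono fun k => nk (k + 1) := fun a b hab =>
    show nk (a + 1) < nk (b + 1) from nk_strictMono (Nat.succ_lt_succ hab)
  have hlim := (hind _ hA).comp hsm.tendsto_atTop
  obtain ⟨k, hk⟩ := (hlim.eventually_lt_const (show (0 : ℝ) < 1 / 2 by norm_num)).exists
  exact absurd (hgap k) (not_le.2 hk)

end

end AdviceTest

/-- **Item stmt-PneNP-2723 (`PseudorandomTwinsImplyTarget`)**: pseudorandom twins above the
uniqueness threshold (`PseudorandomTwinsAbove`, crux #4 of route PhaseTwins) imply the target
`NoFBPPApproxAboveUniqueness` — at the crux's own `(Δ, p, q)`, an FBPP approximator `F ∈ FP` of the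
hard-core count would yield the PPT coin-length-advice test of
`AdviceTest.no_fbpp_approximator_of_twins` with non-vanishing distinguishing gap. [this work] -/
theorem pseudorandomTwinsImplyTarget_proof :
    Summit.PneNP.PneNP.Theses.PhaseTwins.PseudorandomTwinsImplyTarget := by
  unfold Summit.PneNP.PneNP.Theses.PhaseTwins.PseudorandomTwinsImplyTarget
  rintro ⟨Δ, p, q, hΔ, hq, hlam, D₀, D₁, -, -, hind, t, h₀, h₁⟩
  refine ⟨Δ, p, q, hΔ, hq, hlam, ?_⟩
  rintro ⟨F, hF, c, r, happ⟩
  exact AdviceTest.no_fbpp_approximator_of_twins _ D₀ D₁ t hind h₀ h₁ hF c r happ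

end Summit.PneNP.PneNP.Theorems
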